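import Mathlib.Logic.Relation
import Mathlib.Analysis.Real.Sqrt
import Literature.MathematicalPhysics.StatisticalMechanics.BarlowStacking
import HarnessLib

/-!
# Step-connectivity of relaxed hcp (stub S3 of line `IdeatorOneSketch`)

Crux `IsometryAtoms.MinimisingLawsHaveAtoms` (stmt-AtomisticToContinuum-15776), line
`IdeatorOneSketch` (idea `strict-calibration-exactness`), registered stub `stub_hcpStepConnected`.

**Statement.** For `0 < a` and `39/50 · a ≤ h ≤ 17/20 · a`, every point of the relaxed hexagonal
close packing `hcpStacking a h` is reached from the origin by a finite chain of points of the
stacking whose consecutive distances are `≤ 21a/20`, i.e. `Relation.ReflTransGen` of the step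
relation `x, y ∈ hcpStacking a h ∧ dist x y ≤ 21a/20` relates `0` to every point.

**Proof.** A point is `barlowPos a h alternatingHagg k i j`. Walk
`0 = barlowPos 0 0 0 → barlowPos (±1) 0 0 → ⋯ → barlowPos k 0 0` by vertical hops of length
`√(a²/3 + h²)` (`dist_barlowPos_succ_eq` for the alternating Hägg sequence), which is `≤ 21a/20`
as soon as `0 ≤ h ≤ 17a/20` (`a²/3 + (17/20)² a² = 1267/1200 · a² ≤ 1323/1200 · a² = (21/20)² a²`);
then inside layer `k` walk `barlowPos k 0 0 → ⋯ → barlowPos k i 0 → ⋯ → barlowPos k i j` by unit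
steps `u = triangularVec₁ a`, `v = triangularVec₂ a` of length exactly `a ≤ 21a/20` (in one layer
the label terms of `dist_barlowPos_sq` cancel and `dist² = a² (Δi² + Δi Δj + Δj²)`). Each of the
three walks is an induction over `ℤ` (`Int.induction_on`: up by `k ↦ k + 1`, down by
`-n ↦ -n - 1`), packaged once as `reflTransGen_of_int_steps`.

References: T. C. Hales, *Dense Sphere Packings: A Blueprint for Formal Proofs*, LMS LN 400,
CUP 2012, §1.3 (hexagonal layers, HCP pattern `ABAB…`) [HalesDSP2012].
-/

noncomputable section

open Literature.MathematicalPhysics.StatisticalMechanics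

namespace Summit.AtomisticToContinuum.Crystallization.Theorems.IsometryAtomsMinimisingLawsHaveAtoms

/-- **Chains along an integer-indexed path.** If `x` reaches `f 0` and consecutive values
`f k`, `f (k + 1)` are related in both directions, then `x` reaches every `f k`
(induction over `ℤ`, up and down from `0`). -/
theorem reflTransGen_of_int_steps {α : Type*} {r : α → α → Prop} {x : α} (f : ℤ → α)
    (h0 : Relation.ReflTransGen r x (f 0))
    (hup : ∀ k : ℤ, r (f k) (f (k + 1))) (hdown : ∀ k : ℤ, r (f (k + 1)) (f k)) (k : ℤ) :
    Relation.ReflTransGen r x (f k) := by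
  induction k with
  | zero => exact h0
  | succ n ih => exact ih.tail (hup n)
  | pred n ih =>
    have h1 := hdown (-(n : ℤ) - 1)
    rw [sub_add_cancel] at h1
    exact ih.tail h1

/-- **In-layer squared distances of hcp**: inside one layer the label terms cancel and
`dist² = a² (Δi² + Δi Δj + Δj²)` (the triangular quadratic form). -/
theorem dist_hcp_inLayer_sq (a h : ℝ) (k i j i' j' : ℤ) :
    dist (barlowPos a h alternatingHagg k i j) (barlowPos a h alternatingHagg k i' j') ^ 2 =
      a ^ 2 * (((i : ℝ) - i') ^ 2 + ((i : ℝ) - i') * ((j : ℝ) - j') + ((j : ℝ) - j') ^ 2) := by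
  rw [dist_barlowPos_sq]
  have h3 : (√3 : ℝ) ^ 2 = 3 := Real.sq_sqrt (by norm_num)
  linear_combination (a ^ 2 * ((j : ℝ) - j') ^ 2 / 4) * h3

/-- The unit step `u`: `dist (barlowPos k i j) (barlowPos k (i + 1) j) = a` (for `0 < a`). -/
theorem dist_hcp_step_i {a : ℝ} (h : ℝ) (ha : 0 < a) (k i j : ℤ) :
    dist (barlowPos a h alternatingHagg k i j) (barlowPos a h alternatingHagg k (i + 1) j) = a := by
  have h2 : dist (barlowPos a h alternatingHagg k i j)
      (barlowPos a h alternatingHagg k (i + 1) j) ^ 2 = a ^ 2 := by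
    rw [dist_hcp_inLayer_sq]; push_cast; ring
  rw [← Real.sqrt_sq dist_nonneg, h2, Real.sqrt_sq ha.le]

/-- The unit step `v`: `dist (barlowPos k i j) (barlowPos k i (j + 1)) = a` (for `0 < a`). -/
theorem dist_hcp_step_j {a : ℝ} (h : ℝ) (ha : 0 < a) (k i j : ℤ) :
    dist (barlowPos a h alternatingHagg k i j) (barlowPos a h alternatingHagg k i (j + 1)) = a := by
  have h2 : dist (barlowPos a h alternatingHagg k i j)
      (barlowPos a h alternatingHagg k i (j + 1)) ^ 2 = a ^ 2 := by
    rw [dist_hcp_inLayer_sq]; push_cast; ring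
  rw [← Real.sqrt_sq dist_nonneg, h2, Real.sqrt_sq ha.le]

/-- **Vertical hops are short on the box**: `dist (barlowPos (k + 1) i j) (barlowPos k i j)
= √(a²/3 + h²) ≤ 21a/20` whenever `0 < a` and `39/50 · a ≤ h ≤ 17/20 · a`
(`a²/3 + h² ≤ (1/3 + 289/400) a² < (441/400) a²`). -/
theorem dist_hcp_step_k_le {a h : ℝ} (ha : 0 < a) (hh₁ : 39 / 50 * a ≤ h) (hh₂ : h ≤ 17 / 20 * a)
    (k i j : ℤ) :
    dist (barlowPos a h alternatingHagg (k + 1) i j) (barlowPos a h alternatingHagg k i j) ≤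
      21 / 20 * a := by
  rw [dist_barlowPos_succ_eq a h isHaggSeq_alternating, Real.sqrt_le_left (by positivity)]
  have h0 : 0 ≤ h := le_trans (by positivity) hh₁
  nlinarith [mul_nonneg h0 (sub_nonneg.2 hh₂), mul_nonneg ha.le (sub_nonneg.2 hh₂)]

/-- **Reachability of every lattice point** for an abstract relation `r` containing all pairs of
hcp points at distance `≤ 21a/20`: vertical walk to layer `k`, then the two in-layer walks. -/
theorem reflTransGen_barlowPos_of_steps {a h : ℝ}
    {r : EuclideanSpace ℝ (Fin 3) → EuclideanSpace ℝ (Fin 3) → Prop}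
    (ha : 0 < a) (hh₁ : 39 / 50 * a ≤ h) (hh₂ : h ≤ 17 / 20 * a)
    (hr : ∀ k i j k' i' j' : ℤ,
      dist (barlowPos a h alternatingHagg k i j) (barlowPos a h alternatingHagg k' i' j') ≤
        21 / 20 * a →
      r (barlowPos a h alternatingHagg k i j) (barlowPos a h alternatingHagg k' i' j'))
    (k i j : ℤ) :
    Relation.ReflTransGen r 0 (barlowPos a h alternatingHagg k i j) := by
  -- the three kinds of steps, in both directions
  have hk : ∀ k : ℤ,
      r (barlowPos a h alternatingHagg k 0 0) (barlowPos a h alternatingHagg (k + 1) 0 0) ∧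
      r (barlowPos a h alternatingHagg (k + 1) 0 0) (barlowPos a h alternatingHagg k 0 0) :=
    fun k =>
      ⟨hr _ _ _ _ _ _ (by rw [dist_comm]; exact dist_hcp_step_k_le ha hh₁ hh₂ k 0 0),
        hr _ _ _ _ _ _ (dist_hcp_step_k_le ha hh₁ hh₂ k 0 0)⟩
  have hi : ∀ k i : ℤ,
      r (barlowPos a h alternatingHagg k i 0) (barlowPos a h alternatingHagg k (i + 1) 0) ∧
      r (barlowPos a h alternatingHagg k (i + 1) 0) (barlowPos a h alternatingHagg k i 0) :=
    fun k i =>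
      ⟨hr _ _ _ _ _ _ (by rw [dist_hcp_step_i h ha]; linarith),
        hr _ _ _ _ _ _ (by rw [dist_comm, dist_hcp_step_i h ha]; linarith)⟩
  have hj : ∀ k i j : ℤ,
      r (barlowPos a h alternatingHagg k i j) (barlowPos a h alternatingHagg k i (j + 1)) ∧
      r (barlowPos a h alternatingHagg k i (j + 1)) (barlowPos a h alternatingHagg k i j) :=
    fun k i j =>
      ⟨hr _ _ _ _ _ _ (by rw [dist_hcp_step_j h ha]; linarith),
        hr _ _ _ _ _ _ (by rw [dist_comm, dist_hcp_step_j h ha]; linarith)⟩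
  -- the origin is the lattice point `(0, 0, 0)`
  have h00 : barlowPos a h alternatingHagg 0 0 0 = 0 := by simp [barlowPos]
  have h0 : Relation.ReflTransGen r 0 (barlowPos a h alternatingHagg 0 0 0) :=
    h00 ▸ Relation.ReflTransGen.refl
  -- vertical walk, then the two in-layer walks
  have h1 : Relation.ReflTransGen r 0 (barlowPos a h alternatingHagg k 0 0) :=
    reflTransGen_of_int_steps (fun k => barlowPos a h alternatingHagg k 0 0) h0
      (fun k => (hk k).1) (fun k => (hk k).2) k
  have h2 : Relation.ReflTransGen r 0 (barlowPos a h alternatingHagg k i 0) :=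
    reflTransGen_of_int_steps (fun i => barlowPos a h alternatingHagg k i 0) h1
      (fun i => (hi k i).1) (fun i => (hi k i).2) i
  exact reflTransGen_of_int_steps (fun j => barlowPos a h alternatingHagg k i j) h2
    (fun j => (hj k i j).1) (fun j => (hj k i j).2) j

/-- STUB S3 (hcp geometry) of line `IdeatorOneSketch`. **Step-connectivity of relaxed hcp**:
every point of `hcpStacking a h` is reached from the origin by a finite chain of points of the
stacking with consecutive distances `≤ 21a/20` (in-plane steps have length `a`, inter-layer steps
`√(a²/3 + h²) ≤ 21a/20` on the box `39/50 · a ≤ h ≤ 17/20 · a`). -/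
theorem stub_hcpStepConnected : ∀ a h : ℝ, 0 < a → 39 / 50 * a ≤ h → h ≤ 17 / 20 * a →
    ∀ p ∈ hcpStacking a h,
      Relation.ReflTransGen
        (fun x y : EuclideanSpace ℝ (Fin 3) =>
          x ∈ hcpStacking a h ∧ y ∈ hcpStacking a h ∧ dist x y ≤ 21 / 20 * a) 0 p := by
  intro a h ha hh₁ hh₂ p hp
  obtain ⟨k, i, j, rfl⟩ := hp
  exact reflTransGen_barlowPos_of_steps ha hh₁ hh₂
    (fun k i j k' i' j' hd => ⟨⟨k, i, j, rfl⟩, ⟨k', i', j', rfl⟩, hd⟩) k i j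

end Summit.AtomisticToContinuum.Crystallization.Theorems.IsometryAtomsMinimisingLawsHaveAtoms
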